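import Literature.NumberTheory.Rogawski1990.CartanObsFunHasse
import Literature.NumberTheory.Rogawski1990.CartanObstructionSubgroup
import Literature.NumberTheory.Rogawski1990.StabilisationPackageOfObsHasse
import HarnessLib

/-!
# `CartanObsHasse` — Prop. 3.3.1 for the subgroup-valued Cartan obstruction `cartanObs : 𝒞′_𝐀(γ₀) → A(γ₀)` and THE STABILISATION PACKAGE OF A REGULAR
# CLASS OF `U(H)`, `H` ANISOTROPIC, IN HOUSE (Rogawski 1990, §3.3 Prop. 3.3.1 p. 22, §3.5 Prop. 3.5.2 p. 29, §3.6 p. 31, §5.4 (5.4.2)–(5.4.5) pp. 72–74; Kottwitz 1986 §9)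

Topic `NumberTheory/Rogawski1990`; namespace `Literature.NumberTheory.Rogawski1990`; **THEOREMS ONLY** (no definition, no named fact, no instance, no
notation, no `sorry`).  Cell `pub/hodgecm-mathlib`, ENGINE T1 (crux H413 = `stmt-HodgeConjecture-24833`), row G6, piece R7 of `BLUEPRINT-R6dR7-CartanObsHasse`
(0a35b92f) — the LAST piece: ★ R7b `MatchingAdeleG₂.cartanObsFun_eq_zero_iff_exists_isRationalOver` (Prop. 3.3.1 for the obstruction VECTOR) transported to any
lift of the vector into the sum-zero hyperplane `A(γ₀) = cartanObsSubgroup (cartanIndex γ₀)` (§1; R6d (D)'s `cartanObs` is such a lift by R6d (C)'s product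
formula `Σ_𝔪 (cartanObsFun p)_𝔪 = 0`), and ★ R7a (`StabilisationPackageOfObsHasse`) applied to it: the pinned bijection `e(γ₀)`, clause (a) of ★
`GlobalTransferWithStabilisationPackage` in character currency, the package half in its binder shape, and the count (5.4.2)–(5.4.5) at `ι := cartanIndex γ₀` (§2).

HONEST LABEL: with this file the per-`γ₀` stabilisation package `(A, 𝓡, obs, e)` with Prop. 3.3.1 — pin (xv) of the T1 line minus its clause (c) — is ★ for
every regular `γ₀` of an anisotropic `U(H)` over a CM field; clause (c) [(4.3.3) ∕ LanglandsShelstad1987 Thm. 6.4.B] stays printed.  HC_CM is proved only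
modulo the printed citations until rung 0 closes.

## References
* [Rogawski1990] J. D. Rogawski, *Automorphic Representations of Unitary Groups in Three Variables*, Ann. of Math. Stud. 123 (1990), §3.3 Prop. 3.3.1 ∕
  Cor. 3.3.2 p. 22, §3.5 Prop. 3.5.2 p. 29, §3.6 p. 31, §5.4 (5.4.1)–(5.4.5) pp. 72–74.
* [Kottwitz1986] R. E. Kottwitz, *Stable trace formula: elliptic singular terms*, Math. Ann. 275 (1986), §7 Prop. 7.1, §9.
-/

set_option autoImplicit false

noncomputable section

open NumberField IsDedekindDomain
open scoped BigOperators Matrix MatrixGroups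

namespace Literature.NumberTheory.Rogawski1990

open Literature.NumberTheory.Automorphic
open Literature.AlgebraicGeometry.ShimuraVarieties (unitaryGroup hermForm)

/-! ## §0 The Cartan types (1) ∕ (2) ∕ (3): `1 ≤ |cartanIndex γ₀| ≤ 3` for `H` anisotropic -/

section Types

variable {L : Type} [Field L] [NumberField L] [IsCMField L] {H : Matrix (Fin 3) (Fin 3) L} {γ₀ : (UnitaryGroup.cmDatum L 3 H).Rational}

/-- **`1 ≤ |cartanIndex γ₀| ≤ 3` for `H` anisotropic** — every simple factor of `L[γ₀]` is τ-stable and their `L`-degrees sum to `3` (★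
`exists_endoscopicIndex_of_anisotropic`), so the Cartan subgroup of a regular `γ₀` is of type (1), (2) or (3) of [§3.6]: `|ι| = 3, 2, 1`.
[cite: Rogawski1990, §3.6 p. 31; §5.4 p. 74] -/
theorem card_cartanIndexCM_pos_and_le_three (hH : (H.map (cmConjRingHom L))ᵀ = H) (hHd : IsUnit H.det)
    (hanis : ∀ v : Fin 3 → L, hermForm (cmConjRingHom L) H v v = 0 → v = 0)
    (hreg : IsRegularElt ((γ₀ : unitaryGroup (cmConjRingHom L) H).val : GL (Fin 3) L)) [Fintype (cartanIndexCM hH hHd hreg)] :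
    0 < Fintype.card (cartanIndexCM hH hHd hreg) ∧ Fintype.card (cartanIndexCM hH hHd hreg) ≤ 3 := by
  classical
  have h1 := exists_endoscopicIndex_of_anisotropic (F := ↥(maximalRealSubfield L)) (cmConjRingHom L)
    (cmConjRingHom_algebraMap L) (IsCMField.complexConj_apply_apply L) hHd hH (exists_cmConjRingHom_apply_ne L) (γ₀ : unitaryGroup (cmConjRingHom L) H) hreg hanis
  obtain ⟨hdeg, hsum, -⟩ := h1
  have hle : Fintype.card (cartanIndexCM hH hHd hreg) ≤ 3 := by
    rw [← hsum, Fintype.card_eq_sum_ones]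
    exact Finset.sum_le_sum fun 𝔪 _ => hdeg 𝔪
  refine ⟨Fintype.card_pos_iff.2 ?_, hle⟩
  by_contra hne
  rw [not_nonempty_iff] at hne
  rw [Finset.univ_eq_empty, Finset.sum_empty] at hsum
  exact absurd hsum (by norm_num)

/-- `|A(γ₀)| = |𝓡(G_γ₀∕F)| ∈ {1, 2, 4}` for `H` anisotropic: `Nat.card (cartanObsSubgroup (cartanIndex γ₀)) = 2 ^ (|ι| − 1)` with `|ι| ≤ 3` (★ `natCard_cartanObsSubgroup` + §0),
so it divides `4`. [cite: Rogawski1990, §3.6 p. 31; §3.5 Prop. 3.5.2 (c) p. 29] -/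
theorem natCard_cartanObsSubgroup_cartanIndexCM_dvd_four (hH : (H.map (cmConjRingHom L))ᵀ = H) (hHd : IsUnit H.det)
    (hanis : ∀ v : Fin 3 → L, hermForm (cmConjRingHom L) H v v = 0 → v = 0)
    (hreg : IsRegularElt ((γ₀ : unitaryGroup (cmConjRingHom L) H).val : GL (Fin 3) L)) [Fintype (cartanIndexCM hH hHd hreg)] :
    Nat.card ↥(cartanObsSubgroup (cartanIndexCM hH hHd hreg)) ∣ 4 := by
  rw [natCard_cartanObsSubgroup]
  have h3 := (card_cartanIndexCM_pos_and_le_three hH hHd hanis hreg).2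
  rw [show (4 : ℕ) = 2 ^ 2 from rfl]
  exact Nat.pow_dvd_pow 2 (by omega)

end Types

/-! ## §1 Prop. 3.3.1 and the package for ANY lift of the obstruction vector into `A(γ₀)` -/

section Lift

variable {L : Type} [Field L] [NumberField L] [IsCMField L] {H : Matrix (Fin 3) (Fin 3) L} {γ₀ : (UnitaryGroup.cmDatum L 3 H).Rational}

/-- **Prop. 3.3.1 for a subgroup-valued lift of the obstruction vector**: if `obs : 𝒞′_𝐀(γ₀) → A(γ₀) = cartanObsSubgroup (cartanIndex γ₀)` has coordinates
`(obs p)_𝔪 = (cartanObsFun p)_𝔪`, then `obs p = 0 ↔ ∃ γ, p.IsRationalOver γ` (★ R7b, `Subtype.ext`). [cite: Rogawski1990, §3.3 Prop. 3.3.1 p. 22; §3.5 Prop. 3.5.2 (c) p. 29] [cite: Kottwitz1986, §9] -/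
theorem MatchingAdeleG₂.eq_zero_iff_exists_isRationalOver_of_coe_eq_cartanObsFun (hH : (H.map (cmConjRingHom L))ᵀ = H) (hHd : IsUnit H.det)
    (hreg : IsRegularElt ((γ₀ : unitaryGroup (cmConjRingHom L) H).val : GL (Fin 3) L)) [Fintype (cartanIndexCM hH hHd hreg)]
    (obs : MatchingAdeleG₂ L H H γ₀ → ↥(cartanObsSubgroup (cartanIndexCM hH hHd hreg)))
    (hval : ∀ p, ((obs p : ↥(cartanObsSubgroup (cartanIndexCM hH hHd hreg))) : cartanIndexCM hH hHd hreg → ZMod 2) = p.cartanObsFun hH hHd hreg)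
    (p : MatchingAdeleG₂ L H H γ₀) : obs p = 0 ↔ ∃ γ : (UnitaryGroup.cmDatum L 3 H).Rational, p.IsRationalOver γ := by
  rw [← p.cartanObsFun_eq_zero_iff_exists_isRationalOver hH hHd hreg, ← hval p]
  exact ⟨fun h => by rw [h]; rfl, fun h => Subtype.ext h⟩

/-- **The pinned bijection `e(γ₀)` and clause (a) for a lift of the obstruction vector**, `H` anisotropic (★ R7a `exists_endoscopicKappaEquiv_of_obsHasse` ∘ §1).
[cite: Rogawski1990, §3.3 Prop. 3.3.1 p. 22; §5.4 (5.4.5) pp. 72–74; §3.6 p. 31] [cite: Kottwitz1986, §9] -/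
theorem MatchingAdeleG₂.exists_endoscopicKappaEquiv_of_coe_eq_cartanObsFun (hH : (H.map (cmConjRingHom L))ᵀ = H) (hHd : IsUnit H.det)
    (hanis : ∀ v : Fin 3 → L, hermForm (cmConjRingHom L) H v v = 0 → v = 0)
    (hreg : IsRegularElt ((γ₀ : unitaryGroup (cmConjRingHom L) H).val : GL (Fin 3) L)) [Fintype (cartanIndexCM hH hHd hreg)]
    (obs : MatchingAdeleG₂ L H H γ₀ → ↥(cartanObsSubgroup (cartanIndexCM hH hHd hreg)))
    (hval : ∀ p, ((obs p : ↥(cartanObsSubgroup (cartanIndexCM hH hHd hreg))) : cartanIndexCM hH hHd hreg → ZMod 2) = p.cartanObsFun hH hHd hreg) :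
    ∃ (s : {𝒪H : StableClassH (cmConjRingHom L) (Matrix.of fun i j : Fin 2 => if i.val + j.val + 1 = 2 then (1 : L) else 0)
          (Matrix.of fun i j : Fin 1 => if i.val + j.val + 1 = 1 then (1 : L) else 0) //
            𝒪H.TransfersTo H endoForm_antidiagOne (stableClassOf (cmConjRingHom L) H (γ₀ : unitaryGroup (cmConjRingHom L) H))} → cartanIndexCM hH hHd hreg)
      (e : {𝒪H : StableClassH (cmConjRingHom L) (Matrix.of fun i j : Fin 2 => if i.val + j.val + 1 = 2 then (1 : L) else 0)
          (Matrix.of fun i j : Fin 1 => if i.val + j.val + 1 = 1 then (1 : L) else 0) //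
            𝒪H.TransfersTo H endoForm_antidiagOne (stableClassOf (cmConjRingHom L) H (γ₀ : unitaryGroup (cmConjRingHom L) H))} ≃
        {χ : (⊤ : Subgroup (AddChar ↥(cartanObsSubgroup (cartanIndexCM hH hHd hreg)) ℂ)) // χ ≠ 1}),
      Function.Injective s ∧
      (∀ 𝔪 : cartanIndexCM hH hHd hreg, (∃ x, s x = 𝔪) ↔ Module.finrank L (↥(cartanSubalgebra γ₀) ⧸ 𝔪.1.asIdeal) = 1) ∧
      (∀ x, (⟨(((γ₀ : unitaryGroup (cmConjRingHom L) H).val : GL (Fin 3) L) : Matrix (Fin 3) (Fin 3) L), Algebra.self_mem_adjoin_singleton L _⟩ :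
            ↥(cartanSubalgebra γ₀)) - algebraMap L _ x.1.sndVal ∈ (s x).1.asIdeal) ∧
      (∀ x (ε : ↥(cartanObsSubgroup (cartanIndexCM hH hHd hreg))),
        (((e x : (⊤ : Subgroup (AddChar ↥(cartanObsSubgroup (cartanIndexCM hH hHd hreg)) ℂ))) :
            AddChar ↥(cartanObsSubgroup (cartanIndexCM hH hHd hreg)) ℂ)) ε =
          (-1 : ℂ) ^ ((ε : cartanIndexCM hH hHd hreg → ZMod 2) (s x)).val) ∧
      ∀ p : MatchingAdeleG₂ L H H γ₀,
        (∀ κ ∈ (⊤ : Subgroup (AddChar ↥(cartanObsSubgroup (cartanIndexCM hH hHd hreg)) ℂ)), κ (obs p) = 1) ↔ ∃ γ, p.IsRationalOver γ :=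
  MatchingAdeleG₂.exists_endoscopicKappaEquiv_of_obsHasse hH hHd hanis hreg obs
    (MatchingAdeleG₂.eq_zero_iff_exists_isRationalOver_of_coe_eq_cartanObsFun hH hHd hreg obs hval)

/-- **The package half in the binder shape of pin (xv) ∕ ★ `GlobalTransferWithStabilisationPackage`** for a lift of the obstruction vector, `H` anisotropic:
`∃ (A : Type) (_ : AddCommGroup A) (𝓡) (_ : Fintype 𝓡) (obs') (e), ∀ p, (∀ κ ∈ 𝓡, κ (obs' p) = 1) ↔ ∃ γ, p.IsRationalOver γ` — inhabited at `(A(γ₀), ⊤, obs, e(γ₀))`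
(★ R7a `exists_packageHasse_of_obsHasse` ∘ §1); clause (c) [(4.3.3)] is not part of this statement. [cite: Rogawski1990, §3.3 Prop. 3.3.1 p. 22; §5.4 (5.4.5) p. 74] [cite: Kottwitz1986, §9] -/
theorem MatchingAdeleG₂.exists_packageHasse_of_coe_eq_cartanObsFun (hH : (H.map (cmConjRingHom L))ᵀ = H) (hHd : IsUnit H.det)
    (hanis : ∀ v : Fin 3 → L, hermForm (cmConjRingHom L) H v v = 0 → v = 0)
    (hreg : IsRegularElt ((γ₀ : unitaryGroup (cmConjRingHom L) H).val : GL (Fin 3) L)) [Fintype (cartanIndexCM hH hHd hreg)]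
    (obs : MatchingAdeleG₂ L H H γ₀ → ↥(cartanObsSubgroup (cartanIndexCM hH hHd hreg)))
    (hval : ∀ p, ((obs p : ↥(cartanObsSubgroup (cartanIndexCM hH hHd hreg))) : cartanIndexCM hH hHd hreg → ZMod 2) = p.cartanObsFun hH hHd hreg) :
    ∃ (A : Type) (_ : AddCommGroup A) (𝓡 : Subgroup (AddChar A ℂ)) (_ : Fintype 𝓡) (obs' : MatchingAdeleG₂ L H H γ₀ → A)
      (_ : {𝒪H : StableClassH (cmConjRingHom L) (Matrix.of fun i j : Fin 2 => if i.val + j.val + 1 = 2 then (1 : L) else 0)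
          (Matrix.of fun i j : Fin 1 => if i.val + j.val + 1 = 1 then (1 : L) else 0) //
            𝒪H.TransfersTo H endoForm_antidiagOne (stableClassOf (cmConjRingHom L) H (γ₀ : unitaryGroup (cmConjRingHom L) H))} ≃ {χ : 𝓡 // χ ≠ 1}),
      ∀ p : MatchingAdeleG₂ L H H γ₀, (∀ κ ∈ 𝓡, κ (obs' p) = 1) ↔ ∃ γ, p.IsRationalOver γ :=
  MatchingAdeleG₂.exists_packageHasse_of_obsHasse hH hHd hanis hreg obs
    (MatchingAdeleG₂.eq_zero_iff_exists_isRationalOver_of_coe_eq_cartanObsFun hH hHd hreg obs hval)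

/-- **Type (3) rider — ONE τ-stable factor ⇒ no obstruction**: if `cartanIndex γ₀` is a singleton (the Cartan subgroup of `γ₀` is of type (3), `L[γ₀]^τ` a cubic
field), then `A(γ₀) = 0`, so every matching adèle over `γ₀` is rational (print p. 73: «if `T` is of type (3) … every element of `𝒪_st(γ₀∕𝐀)` is conjugate to an
element of `G`»). [cite: Rogawski1990, §3.6 p. 31; §5.4 p. 73] -/
theorem MatchingAdeleG₂.exists_isRationalOver_of_card_cartanIndexCM_eq_one (hH : (H.map (cmConjRingHom L))ᵀ = H) (hHd : IsUnit H.det)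
    (hreg : IsRegularElt ((γ₀ : unitaryGroup (cmConjRingHom L) H).val : GL (Fin 3) L)) [Fintype (cartanIndexCM hH hHd hreg)]
    (hcard : Fintype.card (cartanIndexCM hH hHd hreg) = 1)
    (obs : MatchingAdeleG₂ L H H γ₀ → ↥(cartanObsSubgroup (cartanIndexCM hH hHd hreg)))
    (hval : ∀ p, ((obs p : ↥(cartanObsSubgroup (cartanIndexCM hH hHd hreg))) : cartanIndexCM hH hHd hreg → ZMod 2) = p.cartanObsFun hH hHd hreg)
    (p : MatchingAdeleG₂ L H H γ₀) : ∃ γ : (UnitaryGroup.cmDatum L 3 H).Rational, p.IsRationalOver γ := by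
  rw [← MatchingAdeleG₂.eq_zero_iff_exists_isRationalOver_of_coe_eq_cartanObsFun hH hHd hreg obs hval p]
  -- `A(γ₀)` has `2 ^ (1 - 1) = 1` element
  have hsub : Subsingleton ↥(cartanObsSubgroup (cartanIndexCM hH hHd hreg)) :=
    Finite.card_le_one_iff_subsingleton.1 (le_of_eq (by rw [natCard_cartanObsSubgroup, hcard]; norm_num))
  exact Subsingleton.elim _ _

end Lift

section LiftCount

variable {L : Type} [Field L] [NumberField L] [IsCMField L] {H : Matrix (Fin 3) (Fin 3) L} {γ₀ : (UnitaryGroup.cmDatum L 3 H).Rational}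
variable [∀ g : (UnitaryGroup.cmDatum L 3 H).Adelic,
  MeasurableSpace ((UnitaryGroup.cmDatum L 3 H).Adelic ⧸ Subgroup.centralizer ({g} : Set (UnitaryGroup.cmDatum L 3 H).Adelic))]

/-- **The count (5.4.2)–(5.4.5) for a lift of the obstruction vector**, `H` anisotropic (★ R7a `stableOrbitalSum_map_toAdelic_eq_of_obsHasse` ∘ §1): the only
hypotheses left are the dictionary `s` and the `χ ≠ 1` weights reading the coordinate signs `W x [q] = (−1)^{(obs q)_{s x}} = (−1)^{(cartanObsFun q)_{s x}}`.
[cite: Rogawski1990, §5.4 (5.4.2)–(5.4.5) pp. 72–74; §3.5 Prop. 3.5.2 (c) p. 29] [cite: Kottwitz1986, §9] -/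
theorem MatchingAdeleG₂.stableOrbitalSum_map_toAdelic_eq_of_coe_eq_cartanObsFun (hH : (H.map (cmConjRingHom L))ᵀ = H) (hHd : IsUnit H.det)
    (hanis : ∀ v : Fin 3 → L, hermForm (cmConjRingHom L) H v v = 0 → v = 0)
    (hreg : IsRegularElt ((γ₀ : unitaryGroup (cmConjRingHom L) H).val : GL (Fin 3) L)) [Fintype (cartanIndexCM hH hHd hreg)]
    (obs : MatchingAdeleG₂ L H H γ₀ → ↥(cartanObsSubgroup (cartanIndexCM hH hHd hreg)))
    (hval : ∀ p, ((obs p : ↥(cartanObsSubgroup (cartanIndexCM hH hHd hreg))) : cartanIndexCM hH hHd hreg → ZMod 2) = p.cartanObsFun hH hHd hreg)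
    {I : Type*} [Fintype I] (s : I → cartanIndexCM hH hHd hreg) (hs : Function.Injective s)
    (hrange : ∀ 𝔪 : cartanIndexCM hH hHd hreg, (∃ x, s x = 𝔪) ↔ Module.finrank L (↥(cartanSubalgebra γ₀) ⧸ 𝔪.1.asIdeal) = 1)
    (W : I → ConjClasses (UnitaryGroup.cmDatum L 3 H).Adelic → ℂ)
    (hW : ∀ (x : I) (q : MatchingAdeleG₂ L H H γ₀), W x (ConjClasses.mk q.adele) = (-1 : ℂ) ^ (q.cartanObsFun hH hHd hreg (s x)).val)
    (m : OrbitalMeasureFamily (UnitaryGroup.cmDatum L 3 H).Adelic) (f : (UnitaryGroup.cmDatum L 3 H).Adelic → ℂ)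
    (hfin : (MatchingAdeleG₂.classes L H H γ₀ ∩ Function.support fun δ => classOrbitalIntegral m f δ).Finite) :
    stableOrbitalSum (cmConjRingHom L) H (fun c => classOrbitalIntegral m f (ConjClasses.map (UnitaryGroup.cmDatum L 3 H).toAdelic c)) γ₀ =
      ((Fintype.card I : ℂ) + 1)⁻¹ * (adelicStableOrbitalSum (MatchingAdeleG₂.classes L H H γ₀) m f +
        ∑ x, adelicKappaOrbitalSum (MatchingAdeleG₂.classes L H H γ₀) (W x) m f) :=
  MatchingAdeleG₂.stableOrbitalSum_map_toAdelic_eq_of_obsHasse hH hHd hanis hreg obs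
    (MatchingAdeleG₂.eq_zero_iff_exists_isRationalOver_of_coe_eq_cartanObsFun hH hHd hreg obs hval) s hs hrange W
    (fun x q => by rw [hW, hval]) m f hfin

end LiftCount

/-! ## §2 At R6d (D)'s `cartanObs`: `cartanObsHasse`, the pinned bijection, the package half, the count -/

section CartanObs

variable {L : Type} [Field L] [NumberField L] [IsCMField L] {H : Matrix (Fin 3) (Fin 3) L} {γ₀ : (UnitaryGroup.cmDatum L 3 H).Rational}

/-- **`cartanObsHasse` — PROP. 3.3.1 (KOTTWITZ'S CRITERION) FOR THE CARTAN OBSTRUCTION `cartanObs : 𝒞′_𝐀(γ₀) → A(γ₀)` OF `U(3)`, IN HOUSE.**  For `H`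
hermitian non-degenerate over the CM field `L`, `γ₀ ∈ U(H)(L⁺)` regular and every matching adèle `p ∈ 𝒞′_𝐀(γ₀)`:
`p.cartanObs hH hHd hreg = 0 ↔ ∃ γ, p.IsRationalOver γ` (★ R7b transported along ★ (D) `coe_cartanObs`).  This is the `hHasse` hypothesis of ★
`PreStabilisationCountSigns` ∕ ★ `StabilisationPackageOfObsHasse` and clause (a) of pin (xv) in element form.
[cite: Rogawski1990, §3.3 Prop. 3.3.1 p. 22; §3.5 Prop. 3.5.2 (c) p. 29] [cite: Kottwitz1986, §7 Prop. 7.1, §9] -/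
theorem MatchingAdeleG₂.cartanObs_eq_zero_iff_exists_isRationalOver (hH : (H.map (cmConjRingHom L))ᵀ = H) (hHd : IsUnit H.det)
    (hreg : IsRegularElt ((γ₀ : unitaryGroup (cmConjRingHom L) H).val : GL (Fin 3) L)) [Fintype (cartanIndexCM hH hHd hreg)]
    (p : MatchingAdeleG₂ L H H γ₀) : p.cartanObs hH hHd hreg = 0 ↔ ∃ γ : (UnitaryGroup.cmDatum L 3 H).Rational, p.IsRationalOver γ :=
  MatchingAdeleG₂.eq_zero_iff_exists_isRationalOver_of_coe_eq_cartanObsFun hH hHd hreg (fun q => q.cartanObs hH hHd hreg)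
    (fun q => MatchingAdeleG₂.coe_cartanObs hH hHd hreg q) p

/-- `cartanObsHasse` in the `∀ p` binder shape of ★ `cartanObsHasse_of_steps` ∕ `hHasse`. [cite: Rogawski1990, §3.3 Prop. 3.3.1 p. 22] [cite: Kottwitz1986, §9] -/
theorem cartanObsHasse (hH : (H.map (cmConjRingHom L))ᵀ = H) (hHd : IsUnit H.det)
    (hreg : IsRegularElt ((γ₀ : unitaryGroup (cmConjRingHom L) H).val : GL (Fin 3) L)) [Fintype (cartanIndexCM hH hHd hreg)] :
    ∀ p : MatchingAdeleG₂ L H H γ₀, p.cartanObs hH hHd hreg = 0 ↔ ∃ γ : (UnitaryGroup.cmDatum L 3 H).Rational, p.IsRationalOver γ :=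
  fun p => p.cartanObs_eq_zero_iff_exists_isRationalOver hH hHd hreg

/-- **Clause (a) of pin (xv) in CHARACTER currency for `(A(γ₀), 𝓡 := ⊤, cartanObs)`** (no anisotropy needed): `(∀ κ ∈ ⊤, κ (cartanObs p) = 1) ↔ ∃ γ, p.IsRationalOver γ`
(★ `forall_mem_top_addChar_obs_eq_one_iff`). [cite: Rogawski1990, §3.3 Prop. 3.3.1 ∕ Cor. 3.3.2 p. 22] -/
theorem MatchingAdeleG₂.forall_mem_top_addChar_cartanObs_eq_one_iff (hH : (H.map (cmConjRingHom L))ᵀ = H) (hHd : IsUnit H.det)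
    (hreg : IsRegularElt ((γ₀ : unitaryGroup (cmConjRingHom L) H).val : GL (Fin 3) L)) [Fintype (cartanIndexCM hH hHd hreg)]
    (p : MatchingAdeleG₂ L H H γ₀) :
    (∀ κ ∈ (⊤ : Subgroup (AddChar ↥(cartanObsSubgroup (cartanIndexCM hH hHd hreg)) ℂ)), κ (p.cartanObs hH hHd hreg) = 1) ↔
      ∃ γ : (UnitaryGroup.cmDatum L 3 H).Rational, p.IsRationalOver γ :=
  MatchingAdeleG₂.forall_mem_top_addChar_obs_eq_one_iff (fun q : MatchingAdeleG₂ L H H γ₀ => q.cartanObs hH hHd hreg) (cartanObsHasse hH hHd hreg) p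

/-- **THE PINNED BIJECTION `e(γ₀)` AND CLAUSE (a) FOR KOTTWITZ'S `(A(γ₀), ⊤, cartanObs)`**, `H` anisotropic: `∃ s e`, `s : {𝒪H ↦ 𝒪_st(γ₀)} ↪ cartanIndex γ₀` onto the
degree-one factors with `γ₀ − sndVal 𝒪H ∈ s 𝒪H`, `e : {𝒪H ↦ 𝒪_st(γ₀)} ≃ {χ ∈ ⊤ ∣ χ ≠ 1}` with `e 𝒪H ε = (−1)^{ε (s 𝒪H)}`, and `(∀ κ ∈ ⊤, κ (cartanObs p) = 1) ↔ ∃ γ, p.IsRationalOver γ`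
(★ R7a ∘ `cartanObsHasse`) — the datum `(s, e)` over which ★-to-be F5 `GlobalTransferWithCartanKappaFormula` quantifies its clause (c).
[cite: Rogawski1990, §3.3 Prop. 3.3.1 p. 22; §5.4 (5.4.5) pp. 72–74; §3.6 p. 31] [cite: Kottwitz1986, §9] -/
theorem MatchingAdeleG₂.exists_cartanKappaEquiv (hH : (H.map (cmConjRingHom L))ᵀ = H) (hHd : IsUnit H.det)
    (hanis : ∀ v : Fin 3 → L, hermForm (cmConjRingHom L) H v v = 0 → v = 0)
    (hreg : IsRegularElt ((γ₀ : unitaryGroup (cmConjRingHom L) H).val : GL (Fin 3) L)) [Fintype (cartanIndexCM hH hHd hreg)] :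
    ∃ (s : {𝒪H : StableClassH (cmConjRingHom L) (Matrix.of fun i j : Fin 2 => if i.val + j.val + 1 = 2 then (1 : L) else 0)
          (Matrix.of fun i j : Fin 1 => if i.val + j.val + 1 = 1 then (1 : L) else 0) //
            𝒪H.TransfersTo H endoForm_antidiagOne (stableClassOf (cmConjRingHom L) H (γ₀ : unitaryGroup (cmConjRingHom L) H))} → cartanIndexCM hH hHd hreg)
      (e : {𝒪H : StableClassH (cmConjRingHom L) (Matrix.of fun i j : Fin 2 => if i.val + j.val + 1 = 2 then (1 : L) else 0)
          (Matrix.of fun i j : Fin 1 => if i.val + j.val + 1 = 1 then (1 : L) else 0) //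
            𝒪H.TransfersTo H endoForm_antidiagOne (stableClassOf (cmConjRingHom L) H (γ₀ : unitaryGroup (cmConjRingHom L) H))} ≃
        {χ : (⊤ : Subgroup (AddChar ↥(cartanObsSubgroup (cartanIndexCM hH hHd hreg)) ℂ)) // χ ≠ 1}),
      Function.Injective s ∧
      (∀ 𝔪 : cartanIndexCM hH hHd hreg, (∃ x, s x = 𝔪) ↔ Module.finrank L (↥(cartanSubalgebra γ₀) ⧸ 𝔪.1.asIdeal) = 1) ∧
      (∀ x, (⟨(((γ₀ : unitaryGroup (cmConjRingHom L) H).val : GL (Fin 3) L) : Matrix (Fin 3) (Fin 3) L), Algebra.self_mem_adjoin_singleton L _⟩ :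
            ↥(cartanSubalgebra γ₀)) - algebraMap L _ x.1.sndVal ∈ (s x).1.asIdeal) ∧
      (∀ x (ε : ↥(cartanObsSubgroup (cartanIndexCM hH hHd hreg))),
        (((e x : (⊤ : Subgroup (AddChar ↥(cartanObsSubgroup (cartanIndexCM hH hHd hreg)) ℂ))) :
            AddChar ↥(cartanObsSubgroup (cartanIndexCM hH hHd hreg)) ℂ)) ε =
          (-1 : ℂ) ^ ((ε : cartanIndexCM hH hHd hreg → ZMod 2) (s x)).val) ∧
      ∀ p : MatchingAdeleG₂ L H H γ₀,
        (∀ κ ∈ (⊤ : Subgroup (AddChar ↥(cartanObsSubgroup (cartanIndexCM hH hHd hreg)) ℂ)), κ (p.cartanObs hH hHd hreg) = 1) ↔ ∃ γ, p.IsRationalOver γ :=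
  MatchingAdeleG₂.exists_endoscopicKappaEquiv_of_coe_eq_cartanObsFun hH hHd hanis hreg (fun q => q.cartanObs hH hHd hreg)
    (fun q => MatchingAdeleG₂.coe_cartanObs hH hHd hreg q)

/-- **The dictionary is unique**: two maps `s, s' : {𝒪H ↦ 𝒪_st(γ₀)} → cartanIndex γ₀` with `γ₀ − sndVal 𝒪H ∈ s 𝒪H`, `∈ s' 𝒪H` agree — the maximal ideal of
`L[γ₀]` containing `γ₀ − u` is unique (★ `maximalSpectrum_eq_of_matrixGen_sub_algebraMap_mem`).  So the `∀ s` of ★-to-be F5 `GlobalTransferWithCartanKappaFormula`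
ranges over a singleton. [cite: Rogawski1990, §3.6 p. 31; §5.4 (5.4.5) p. 74] -/
theorem cartanKappaIndex_unique (hH : (H.map (cmConjRingHom L))ᵀ = H) (hHd : IsUnit H.det)
    (hreg : IsRegularElt ((γ₀ : unitaryGroup (cmConjRingHom L) H).val : GL (Fin 3) L))
    {s s' : {𝒪H : StableClassH (cmConjRingHom L) (Matrix.of fun i j : Fin 2 => if i.val + j.val + 1 = 2 then (1 : L) else 0)
          (Matrix.of fun i j : Fin 1 => if i.val + j.val + 1 = 1 then (1 : L) else 0) //
            𝒪H.TransfersTo H endoForm_antidiagOne (stableClassOf (cmConjRingHom L) H (γ₀ : unitaryGroup (cmConjRingHom L) H))} → cartanIndexCM hH hHd hreg}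
    (hpin : ∀ x, (⟨(((γ₀ : unitaryGroup (cmConjRingHom L) H).val : GL (Fin 3) L) : Matrix (Fin 3) (Fin 3) L), Algebra.self_mem_adjoin_singleton L _⟩ :
            ↥(cartanSubalgebra γ₀)) - algebraMap L _ x.1.sndVal ∈ (s x).1.asIdeal)
    (hpin' : ∀ x, (⟨(((γ₀ : unitaryGroup (cmConjRingHom L) H).val : GL (Fin 3) L) : Matrix (Fin 3) (Fin 3) L), Algebra.self_mem_adjoin_singleton L _⟩ :
            ↥(cartanSubalgebra γ₀)) - algebraMap L _ x.1.sndVal ∈ (s' x).1.asIdeal) :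
    s = s' := by
  funext x
  apply Subtype.ext
  exact Literature.LinearAlgebra.Matrix.maximalSpectrum_eq_of_matrixGen_sub_algebraMap_mem
    (γ := (((γ₀ : unitaryGroup (cmConjRingHom L) H).val : GL (Fin 3) L) : Matrix (Fin 3) (Fin 3) L)) (𝔪 := (s x).1) (𝔫 := (s' x).1)
    (u := x.1.sndVal) (hpin x) (hpin' x)

/-- **The pinned bijection is unique**: for a fixed dictionary `s`, two bijections `e, e' : {𝒪H ↦ 𝒪_st(γ₀)} ≃ {χ ∈ ⊤ ∣ χ ≠ 1}` with
`e 𝒪H ε = (−1)^{ε (s 𝒪H)} = e' 𝒪H ε` agree (characters are determined by their values).  With `cartanKappaIndex_unique`: the datum `(s, e)` of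
`exists_cartanKappaEquiv` is UNIQUE, so F5's `∀ s e` quantifies over exactly print's `𝒪H ↦ κ(𝒪H)` of (5.4.5). [cite: Rogawski1990, §5.4 (5.4.5) p. 74] -/
theorem cartanKappaEquiv_unique (hH : (H.map (cmConjRingHom L))ᵀ = H) (hHd : IsUnit H.det)
    (hreg : IsRegularElt ((γ₀ : unitaryGroup (cmConjRingHom L) H).val : GL (Fin 3) L)) [Fintype (cartanIndexCM hH hHd hreg)]
    (s : {𝒪H : StableClassH (cmConjRingHom L) (Matrix.of fun i j : Fin 2 => if i.val + j.val + 1 = 2 then (1 : L) else 0)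
          (Matrix.of fun i j : Fin 1 => if i.val + j.val + 1 = 1 then (1 : L) else 0) //
            𝒪H.TransfersTo H endoForm_antidiagOne (stableClassOf (cmConjRingHom L) H (γ₀ : unitaryGroup (cmConjRingHom L) H))} → cartanIndexCM hH hHd hreg)
    {e e' : {𝒪H : StableClassH (cmConjRingHom L) (Matrix.of fun i j : Fin 2 => if i.val + j.val + 1 = 2 then (1 : L) else 0)
          (Matrix.of fun i j : Fin 1 => if i.val + j.val + 1 = 1 then (1 : L) else 0) //
            𝒪H.TransfersTo H endoForm_antidiagOne (stableClassOf (cmConjRingHom L) H (γ₀ : unitaryGroup (cmConjRingHom L) H))} ≃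
        {χ : (⊤ : Subgroup (AddChar ↥(cartanObsSubgroup (cartanIndexCM hH hHd hreg)) ℂ)) // χ ≠ 1}}
    (he : ∀ x (ε : ↥(cartanObsSubgroup (cartanIndexCM hH hHd hreg))),
        (((e x : (⊤ : Subgroup (AddChar ↥(cartanObsSubgroup (cartanIndexCM hH hHd hreg)) ℂ))) :
            AddChar ↥(cartanObsSubgroup (cartanIndexCM hH hHd hreg)) ℂ)) ε = (-1 : ℂ) ^ ((ε : cartanIndexCM hH hHd hreg → ZMod 2) (s x)).val)
    (he' : ∀ x (ε : ↥(cartanObsSubgroup (cartanIndexCM hH hHd hreg))),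
        (((e' x : (⊤ : Subgroup (AddChar ↥(cartanObsSubgroup (cartanIndexCM hH hHd hreg)) ℂ))) :
            AddChar ↥(cartanObsSubgroup (cartanIndexCM hH hHd hreg)) ℂ)) ε = (-1 : ℂ) ^ ((ε : cartanIndexCM hH hHd hreg → ZMod 2) (s x)).val) :
    e = e' :=
  Equiv.ext fun x => Subtype.ext (Subtype.ext (AddChar.ext _ _ fun ε => (he x ε).trans (he' x ε).symm))

/-- **THE STABILISATION PACKAGE OF A REGULAR CLASS OF `U(H)`, `H` ANISOTROPIC — pin (xv) of the T1 line ∕ the last conjunct of ★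
`GlobalTransferWithStabilisationPackage`, MINUS its clause (c), IN HOUSE**: `∃ (A : Type) (_ : AddCommGroup A) (𝓡 : Subgroup (AddChar A ℂ)) (_ : Fintype 𝓡)
(obs : 𝒞′_𝐀(γ₀) → A) (e : {𝒪H ↦ 𝒪_st(γ₀)} ≃ {χ : 𝓡 // χ ≠ 1}), ∀ p, (∀ κ ∈ 𝓡, κ (obs p) = 1) ↔ ∃ γ, p.IsRationalOver γ`, witnessed by Kottwitz's
`(A(γ₀) = 𝔈(T_{γ₀}∕F), 𝓡(T_{γ₀}∕F) = ⊤, cartanObs, e(γ₀))`. [cite: Rogawski1990, §3.3 Prop. 3.3.1 p. 22; §3.5 Prop. 3.5.2 p. 29; §5.4 (5.4.5) pp. 72–74] [cite: Kottwitz1986, §9] -/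
theorem MatchingAdeleG₂.exists_stabilisationPackage (hH : (H.map (cmConjRingHom L))ᵀ = H) (hHd : IsUnit H.det)
    (hanis : ∀ v : Fin 3 → L, hermForm (cmConjRingHom L) H v v = 0 → v = 0)
    (hreg : IsRegularElt ((γ₀ : unitaryGroup (cmConjRingHom L) H).val : GL (Fin 3) L)) :
    ∃ (A : Type) (_ : AddCommGroup A) (𝓡 : Subgroup (AddChar A ℂ)) (_ : Fintype 𝓡) (obs : MatchingAdeleG₂ L H H γ₀ → A)
      (_ : {𝒪H : StableClassH (cmConjRingHom L) (Matrix.of fun i j : Fin 2 => if i.val + j.val + 1 = 2 then (1 : L) else 0)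
          (Matrix.of fun i j : Fin 1 => if i.val + j.val + 1 = 1 then (1 : L) else 0) //
            𝒪H.TransfersTo H endoForm_antidiagOne (stableClassOf (cmConjRingHom L) H (γ₀ : unitaryGroup (cmConjRingHom L) H))} ≃ {χ : 𝓡 // χ ≠ 1}),
      ∀ p : MatchingAdeleG₂ L H H γ₀, (∀ κ ∈ 𝓡, κ (obs p) = 1) ↔ ∃ γ, p.IsRationalOver γ := by
  haveI : Finite (cartanIndexCM hH hHd hreg) :=
    finite_cartanIndex (cmConjRingHom L) (cmConjRingHom_algebraMap L) (IsCMField.complexConj_apply_apply L) hHd hH hreg (transpose_map_mul_mul_eq_of_rational γ₀)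
  haveI : Fintype (cartanIndexCM hH hHd hreg) := Fintype.ofFinite _
  exact MatchingAdeleG₂.exists_packageHasse_of_coe_eq_cartanObsFun hH hHd hanis hreg (fun q => q.cartanObs hH hHd hreg)
    (fun q => MatchingAdeleG₂.coe_cartanObs hH hHd hreg q)

/-- **Type (3): no obstruction** — if `|cartanIndex γ₀| = 1` then every matching adèle over `γ₀` is rational. [cite: Rogawski1990, §3.6 p. 31; §5.4 p. 73] -/
theorem MatchingAdeleG₂.exists_isRationalOver_of_card_cartanIndexCM_eq_one' (hH : (H.map (cmConjRingHom L))ᵀ = H) (hHd : IsUnit H.det)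
    (hreg : IsRegularElt ((γ₀ : unitaryGroup (cmConjRingHom L) H).val : GL (Fin 3) L)) [Fintype (cartanIndexCM hH hHd hreg)]
    (hcard : Fintype.card (cartanIndexCM hH hHd hreg) = 1) (p : MatchingAdeleG₂ L H H γ₀) :
    ∃ γ : (UnitaryGroup.cmDatum L 3 H).Rational, p.IsRationalOver γ :=
  MatchingAdeleG₂.exists_isRationalOver_of_card_cartanIndexCM_eq_one hH hHd hreg hcard (fun q => q.cartanObs hH hHd hreg)
    (fun q => MatchingAdeleG₂.coe_cartanObs hH hHd hreg q) p

end CartanObs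

section CartanObsCount

variable {L : Type} [Field L] [NumberField L] [IsCMField L] {H : Matrix (Fin 3) (Fin 3) L} {γ₀ : (UnitaryGroup.cmDatum L 3 H).Rational}
variable [∀ g : (UnitaryGroup.cmDatum L 3 H).Adelic,
  MeasurableSpace ((UnitaryGroup.cmDatum L 3 H).Adelic ⧸ Subgroup.centralizer ({g} : Set (UnitaryGroup.cmDatum L 3 H).Adelic))]

/-- **THE PRE-STABILISATION COUNT (5.4.2)–(5.4.5) FOR KOTTWITZ'S `cartanObs`**, `H` anisotropic: with a dictionary `s : I ↪ cartanIndex γ₀` onto the degree-one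
factors (e.g. `exists_cartanKappaEquiv`'s) and `χ ≠ 1` class weights `W x [q] = (−1)^{(cartanObsFun q)_{s x}}`,
`Σ_{[γ] ⊂ 𝒪_st(γ₀)} Φ_m([toAdelic γ], f) = (#I + 1)⁻¹ · (Φ^{st,𝐀}(γ₀, f) + Σ_{x ∈ I} adelicKappaOrbitalSum 𝒞′_𝐀(γ₀) (W x) m f)` — every hypothesis of ★
`MatchingAdeleG₂.stableOrbitalSum_map_toAdelic_eq_of_sum_deg_eq_three` except `(s, W, m, f, hfin)` DISCHARGED in house.
[cite: Rogawski1990, §5.4 (5.4.2)–(5.4.5) pp. 72–74; §3.5 Prop. 3.5.2 (c) p. 29; §3.3 Prop. 3.3.1 p. 22] [cite: Kottwitz1986, §9] -/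
theorem MatchingAdeleG₂.stableOrbitalSum_map_toAdelic_eq_of_cartanObs (hH : (H.map (cmConjRingHom L))ᵀ = H) (hHd : IsUnit H.det)
    (hanis : ∀ v : Fin 3 → L, hermForm (cmConjRingHom L) H v v = 0 → v = 0)
    (hreg : IsRegularElt ((γ₀ : unitaryGroup (cmConjRingHom L) H).val : GL (Fin 3) L)) [Fintype (cartanIndexCM hH hHd hreg)]
    {I : Type*} [Fintype I] (s : I → cartanIndexCM hH hHd hreg) (hs : Function.Injective s)
    (hrange : ∀ 𝔪 : cartanIndexCM hH hHd hreg, (∃ x, s x = 𝔪) ↔ Module.finrank L (↥(cartanSubalgebra γ₀) ⧸ 𝔪.1.asIdeal) = 1)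
    (W : I → ConjClasses (UnitaryGroup.cmDatum L 3 H).Adelic → ℂ)
    (hW : ∀ (x : I) (q : MatchingAdeleG₂ L H H γ₀), W x (ConjClasses.mk q.adele) = (-1 : ℂ) ^ (q.cartanObsFun hH hHd hreg (s x)).val)
    (m : OrbitalMeasureFamily (UnitaryGroup.cmDatum L 3 H).Adelic) (f : (UnitaryGroup.cmDatum L 3 H).Adelic → ℂ)
    (hfin : (MatchingAdeleG₂.classes L H H γ₀ ∩ Function.support fun δ => classOrbitalIntegral m f δ).Finite) :
    stableOrbitalSum (cmConjRingHom L) H (fun c => classOrbitalIntegral m f (ConjClasses.map (UnitaryGroup.cmDatum L 3 H).toAdelic c)) γ₀ =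
      ((Fintype.card I : ℂ) + 1)⁻¹ * (adelicStableOrbitalSum (MatchingAdeleG₂.classes L H H γ₀) m f +
        ∑ x, adelicKappaOrbitalSum (MatchingAdeleG₂.classes L H H γ₀) (W x) m f) :=
  MatchingAdeleG₂.stableOrbitalSum_map_toAdelic_eq_of_coe_eq_cartanObsFun hH hHd hanis hreg (fun q => q.cartanObs hH hHd hreg)
    (fun q => MatchingAdeleG₂.coe_cartanObs hH hHd hreg q) s hs hrange W hW m f hfin

end CartanObsCount



end Literature.NumberTheory.Rogawski1990

end
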